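import Literature.IUT.HodgeTheaters.Cor53ivAtTemperedFrobenioid
import Literature.IUT.HodgeTheaters.Cor53RigidOverBaseOfRatioRigidity
import Literature.AlgebraicGeometry.Frobenioids.ModelFrobenioidBaseChangeEquivalence
import HarnessLib

/-!
# [IUTchI] Cor 5.3 (iv), SURJECTIVITY half, AT an [EtTh] Def 3.6 tempered Frobenioid: every self-equivalence of the
# base `𝒟_v` lifts to `ℱ̲_v` — from a DATA ACTION of «scheme automorphisms» (construction-functoriality) and the
# [AbsTopIII] Thm 1.9-shape «every automorphism of the base is geometric», by [FrdI] Thm 5.2 (i) / Cor 5.4 transport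

S. Mochizuki, *Inter-universal Teichmüller theory I*, kurims manuscript (May 2020), §5 Corollary 5.3 (iv) p. 144 l. 20–23
(«Let `v̲ ∈ 𝕍^bad` … Then the natural homomorphism `Aut(ℱ̲_v̲) → Aut(𝒟_v̲)` … is bijective»), proof p. 144 l. 37–40: «since
automorphisms of `𝒟_v̲ = ℬ^temp(X̲_v̲)⁰` necessarily arise from automorphisms of the scheme `X̲_v̲` [cf. [AbsTopIII], Theorem 1.9;
[AbsTopIII], Remark 1.9.1], surjectivity follows immediately from the construction of `ℱ̲_v̲`» ([IUTchI] Cor 5.3 (iv) p.144)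
[claim: Mochizuki2012, status: disputed] (D-0012 claim key; nothing of the series is asserted; no side taken on [IUTchIII] Cor. 3.12).
[FrdI]: S. Mochizuki, *The geometry of Frobenioids I*, Kyushu J. Math. **62** (2008), Thm 5.2 (i) p. 100 (the model Frobenioid of
`(Φ, B, Div_B)`), Cor 5.4 p. 104 («the horizontal arrows are equivalences») [cite: MochizukiFrdI2008, Cor. 5.4 p.104]; [EtTh]:
*The étale theta function …*, Def 3.6 p. 77 [cite: MochizukiEtTh2009, Def 3.6 p.77]; [AbsTopIII] Thm 1.9 p. 37 (tree: abc-iut-L4's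
NAMED FACT `Literature.AnabelianGeometry.AbsoluteAnabelian.AbsTopIII.Thm_1_9`, FACT-LIST F-0399 — cited BY NAME only; it is the
NF-portion RECONSTRUCTION statement and is NOT consumed as a term here, nor restated).

PROOF-ONLY (theorems only; cell abc-iut, seat abc-iut-L5-t1 gen 13, row «COR53IV-SURJ@TEMPERED-BASE» = lane 2 on token
IUTchI:Cor5.3(iv), abc-iut-L5-lead gen 9 KEY 10:47:43Z; sizing memo HOME/staging/L5/L5-t1/g13/C53IV-SURJ-SIZING.md).
CARRIER OF RECORD = the [EtTh] Def 3.6 tempered Frobenioid `C : TemperedFrobenioid T D VD` (abc-iut-L2-t3), whose category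
`C.category = ModelFrobenioid C.divisorMonoid C.ratFnFunctor C.divBNatTrans` is an [FrdI] Thm 5.2 MODEL Frobenioid over `D`; this is the
carrier of the (iv) file of record `Cor53ivAtTemperedFrobenioid` (abc-iut-L5-t4), whose bijective form
`Cor53.tempered_descendBijective_of_monoidRigid_of_lifts` takes the surjectivity binder
`hlift : ∀ Θ : D ≌ D, ∃ Ψ : C.category ≌ C.category, Nonempty (LiesUnder Base Base Ψ Θ)`.  THIS FILE DISCHARGES `hlift` from:

* LAW (construction-functoriality, DISPLAYED): a DATA ACTION — a family `ρ : G → (D ≌ D)` of base self-equivalences («the automorphisms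
  of the scheme `X̲_v̲` acting on `ℬ^temp(X̲_v̲)⁰`») together with, for each `g`, an isomorphism of the model data over `ρ g`,
  `δ g : ModelFrobenioid.DataHomOver (ρ g).functor Div_B Div_B` with bijective components («pulling back divisors and rational functions
  via `g`», the [FrdI] Thm 6.2 (i) shape, abc-iut-w5-d048);
* FACT-SHAPE `hgeom` (DISPLAYED): every self-equivalence of `D` is isomorphic to some `ρ g` — print's «automorphisms of `𝒟_v̲` necessarily
  arise from automorphisms of the scheme `X̲_v̲`» ([AbsTopIII] Thm 1.9 / Rmk 1.9.1 shape);
* ENGINE (PROVED in tree): [FrdI] Thm 5.2 (i) / Cor 5.4 transport — `DataHomOver.functor` lies over its base functor ON THE NOSE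
  (`functor_comp_baseFunctor`, abc-iut-w5-d048) and is an equivalence for bijective components over an equivalence of bases
  (`DataHomOver.functor_isEquivalence`, abc-iut-w5-d137); `LiesUnder.ofIsoLower` (abc-iut-L5 §0 conventions).

Contents: §1 generic at ANY model Frobenioid (`exists_liesUnder_of_dataHomOver`, `lifts_of_dataAction`); §2 at the [EtTh] carrier
(`tempered_lifts_of_dataAction` = `hlift` VERBATIM; knit `tempered_descendBijective_of_monoidRigid_of_dataAction` = t4's bijective form
with `hlift` DISCHARGED); §3 NON-VACUITY of the generic engine at a toy datum (the zero-data model Frobenioid over any base: EVERY `Θ`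
lifts, in particular non-identity ones); §4 (v2, append-only) the TWO-LANE JUNCTION in lane 1's currency
(`tempered_descendBijective_of_rigidOverBase_of_dataAction`: `DescendBijective` ⟸ `RigidOverBase` + data action) and its `hrat` twin.

BINDER CENSUS of the knit (abc-iut-L5-lead RULINGS #110 (4) grammar): LAW {hmon (lane 1, «COR53IV-HRAT@THETA-FROBENIOID»), δ
(construction-functoriality)} · FACT-SHAPE {hgeom ≙ [AbsTopIII] Thm 1.9 / Rmk 1.9.1; F-0399 by name in prose only} · side ∅ · DATA {C, G, ρ}
+ the six [FrdI] standing hypotheses BY NAME.  HONEST LABEL: «at the [EtTh] Def 3.6 carrier; at `v̲` itself the genuine tempered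
Frobenioid of the Tate curve is FOUNDATIONS-14 (GAP G-L5-EX32I-1), where `δ` would become a theorem»; a lift over OUR carrier is OUR
theorem about OUR model; typed ≠ proved for hmon/δ/hgeom; nothing here asserts abc proved or refuted.  No definitions, no instances.
-/

namespace Literature.IUT.HodgeTheaters

open CategoryTheory Opposite Function Literature.AlgebraicGeometry.Frobenioids Literature.AnabelianGeometry.EtaleTheta

namespace Cor53iv

/-! ### §1. Generic: a model Frobenioid lifts every base self-equivalence along which its DATA is transported -/

section Generic

universe w v u uG

variable {D : Type u} [Category.{v} D] {Φ B : Dᵒᵖ ⥤ CommMonCat.{w}} {DivB : B ⟶ monoidGp Φ}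

/-- **[FrdI] Thm 5.2 (i) / Cor 5.4 transport, in the `LiesUnder` currency of [IUTchI] Cor 5.3**: an isomorphism of model data
`(Φ, B, Div_B) → (Φ, B, Div_B)` OVER a self-equivalence `Θ` of the base — `η : Φ ⟶ Θ^*Φ`, `β : B ⟶ Θ^*B` with bijective components,
compatible with `Div_B` (abc-iut-w5-d048's `DataHomOver Θ.functor`) — induces a self-equivalence `Ψ` of the model Frobenioid
`ModelFrobenioid Φ B Div_B` LYING OVER `Θ`: `Ψ := (A, α) ↦ (Θ A, η^gp α)`, `(d, f, Div, u) ↦ (d, Θ f, η Div, β u)`, an equivalence by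
`DataHomOver.functor_isEquivalence` (Cor 5.4 «the horizontal arrows are equivalences»), over `Θ` on the nose
(`functor_comp_baseFunctor`). ([IUTchI] Cor 5.3 (iv) p.144) [cite: MochizukiFrdI2008, Cor. 5.4 p.104]
[claim: Mochizuki2012, status: disputed] -/
theorem exists_liesUnder_of_dataHomOver (Θ : D ≌ D) (h : ModelFrobenioid.DataHomOver Θ.functor DivB DivB)
    (hη : ∀ X : D, Bijective (h.η.app (op X)).hom) (hβ : ∀ X : D, Bijective (h.β.app (op X)).hom) :
    ∃ Ψ : ModelFrobenioid Φ B DivB ≌ ModelFrobenioid Φ B DivB,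
      Nonempty (CatIsomorphism.LiesUnder (ModelFrobenioid.baseFunctor Φ B DivB) (ModelFrobenioid.baseFunctor Φ B DivB) Ψ Θ) := by
  haveI := h.functor_isEquivalence hη hβ
  exact ⟨h.functor.asEquivalence, ⟨eqToIso h.functor_comp_baseFunctor⟩⟩

variable {G : Type uG}

/-- **SURJECTIVITY of `Aut(C) → Aut(D)` at a model Frobenioid from a DATA ACTION** («surjectivity follows immediately from the
construction of `ℱ̲_v̲`», p. 144 l. 39–40, made precise): if a family `ρ : G → (D ≌ D)` of base self-equivalences («the automorphisms
of the scheme `X̲_v̲`») acts on the model data over itself — `δ g : DataHomOver (ρ g).functor Div_B Div_B` with bijective components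
(construction-functoriality LAW) — and EVERY self-equivalence of `D` is isomorphic to some `ρ g` («automorphisms of
`𝒟_v̲ = ℬ^temp(X̲_v̲)⁰` necessarily arise from automorphisms of the scheme `X̲_v̲` [cf. [AbsTopIII], Theorem 1.9; Remark 1.9.1]»,
FACT-SHAPE `hgeom`), then every self-equivalence of `D` lies under a self-equivalence of `ModelFrobenioid Φ B Div_B`.
([IUTchI] Cor 5.3 (iv) p.144) [cite: MochizukiFrdI2008, Cor. 5.4 p.104] [claim: Mochizuki2012, status: disputed] -/
theorem lifts_of_dataAction (ρ : G → (D ≌ D)) (δ : ∀ g, ModelFrobenioid.DataHomOver (ρ g).functor DivB DivB)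
    (hδη : ∀ g (X : D), Bijective ((δ g).η.app (op X)).hom) (hδβ : ∀ g (X : D), Bijective ((δ g).β.app (op X)).hom)
    (hgeom : ∀ Θ : D ≌ D, ∃ g, Nonempty ((ρ g).functor ≅ Θ.functor)) (Θ : D ≌ D) :
    ∃ Ψ : ModelFrobenioid Φ B DivB ≌ ModelFrobenioid Φ B DivB,
      Nonempty (CatIsomorphism.LiesUnder (ModelFrobenioid.baseFunctor Φ B DivB) (ModelFrobenioid.baseFunctor Φ B DivB) Ψ Θ) := by
  obtain ⟨g, ⟨j⟩⟩ := hgeom Θ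
  obtain ⟨Ψ, ⟨i⟩⟩ := exists_liesUnder_of_dataHomOver (ρ g) (δ g) (hδη g) (hδβ g)
  exact ⟨Ψ, ⟨i.ofIsoLower j⟩⟩

end Generic

/-! ### §2. At the [EtTh] Def 3.6 tempered Frobenioid: the `hlift` binder of `Cor53ivAtTemperedFrobenioid` DISCHARGED -/

section Tempered

universe u₀ v₀ u v w uG

variable {D₀ : Type u₀} [Category.{v₀} D₀] {V : FrdIMonoidStub.{w}} {T : RealifiedDivisorMonoids (D₀ := D₀) V}
  {D : Type u} [Category.{v} D] {VD : FrdICatStub.{u, v, w} D} (C : TemperedFrobenioid T D VD) {G : Type uG}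

/-- **[IUTchI] Cor 5.3 (iv), SURJECTIVITY half, AT every [EtTh] Def 3.6 tempered Frobenioid `C` over `D`** — the binder `hlift` of
abc-iut-L5-t4's `Cor53.tempered_descendBijective_of_monoidRigid_of_lifts`, VERBATIM, from a data action: if `ρ : G → (D ≌ D)` acts on
the data `(Φ, B, B → Φ^gp)` of `C` over itself (`δ`, bijective components: «the construction of `ℱ̲_v̲`» is functorial in `G`) and every
self-equivalence of `D` is `≅ ρ g` for some `g` (`hgeom`: «automorphisms of `𝒟_v̲ = ℬ^temp(X̲_v̲)⁰` necessarily arise from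
automorphisms of the scheme `X̲_v̲`», [AbsTopIII] Thm 1.9 / Rmk 1.9.1 shape — abc-iut-L4's F-0399 `Thm_1_9` by name, not consumed),
then every `Θ : D ≌ D` lies under some `Ψ : C.category ≌ C.category`.  HONEST LABEL: at the [EtTh] carrier; at `v̲` itself
FOUNDATIONS-14. ([IUTchI] Cor 5.3 (iv) p.144) [cite: MochizukiEtTh2009, Def 3.6 p.77] [claim: Mochizuki2012, status: disputed] -/
theorem tempered_lifts_of_dataAction (ρ : G → (D ≌ D))
    (δ : ∀ g, ModelFrobenioid.DataHomOver (ρ g).functor C.divBNatTrans C.divBNatTrans)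
    (hδη : ∀ g (X : D), Bijective ((δ g).η.app (op X)).hom) (hδβ : ∀ g (X : D), Bijective ((δ g).β.app (op X)).hom)
    (hgeom : ∀ Θ : D ≌ D, ∃ g, Nonempty ((ρ g).functor ≅ Θ.functor)) :
    ∀ Θ : D ≌ D, ∃ Ψ : C.category ≌ C.category,
      Nonempty (CatIsomorphism.LiesUnder C.baseFunctorOfCategory C.baseFunctorOfCategory Ψ Θ) :=
  fun Θ => lifts_of_dataAction ρ δ hδη hδβ hgeom Θ

/-- **[IUTchI] Cor 5.3 (iv) AS PRINTED («is bijective») AT every [EtTh] Def 3.6 tempered Frobenioid, surjectivity DISCHARGED** from the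
data action: abc-iut-L5-t4's `Cor53.tempered_descendBijective_of_monoidRigid_of_lifts` with `hlift := tempered_lifts_of_dataAction`.
Remaining binders: the six [FrdI] standing hypotheses BY NAME; LAW `hmon` (injectivity content S3–S5, p. 145 — lane 1's target);
LAW `δ` (construction-functoriality); FACT-SHAPE `hgeom` ([AbsTopIII] Thm 1.9 / Rmk 1.9.1).  No token flip claimed.
([IUTchI] Cor 5.3 (iv) p.144) [cite: MochizukiEtTh2009, Def 3.6 p.77] [claim: Mochizuki2012, status: disputed] -/
theorem tempered_descendBijective_of_monoidRigid_of_dataAction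
    (h : ModelFrobenioid.Hypotheses C.divisorMonoid C.ratFnFunctor)
    (hpf : Objectwise (fun M _ => IsPerfFactorial M) C.divisorMonoid) (hsl : IsSlim D) (hfs : IsOfFSMFFType D)
    (hnd : IsNonDilatingOn C.divisorMonoid) (hz : ¬ ModelFrobenioid.IsZeroMonoid C.divisorMonoid)
    (hmon : ∀ Ψ : C.category ≌ C.category,
      Nonempty (Ψ.functor ⋙ C.baseFunctorOfCategory ≅ C.baseFunctorOfCategory) →
      ∃ η : Ψ.functor ⋙ C.baseFunctorOfCategory ≅ C.baseFunctorOfCategory,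
        (∀ ⦃X Y : C.category⦄ (φ : X ⟶ Y),
            ModelFrobenioid.div (Ψ.functor.map φ) =
              pull C.divisorMonoid (η.hom.app X : (Ψ.functor.obj X).base ⟶ X.base) (ModelFrobenioid.div φ)) ∧
        (∀ ⦃X Y : C.category⦄ (φ : X ⟶ Y),
            ModelFrobenioid.unit (Ψ.functor.map φ) =
              pull C.ratFnFunctor (η.hom.app X : (Ψ.functor.obj X).base ⟶ X.base) (ModelFrobenioid.unit φ)))
    (ρ : G → (D ≌ D)) (δ : ∀ g, ModelFrobenioid.DataHomOver (ρ g).functor C.divBNatTrans C.divBNatTrans)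
    (hδη : ∀ g (X : D), Bijective ((δ g).η.app (op X)).hom) (hδβ : ∀ g (X : D), Bijective ((δ g).β.app (op X)).hom)
    (hgeom : ∀ Θ : D ≌ D, ∃ g, Nonempty ((ρ g).functor ≅ Θ.functor)) :
    CatIsomorphism.DescendBijective C.baseFunctorOfCategory C.baseFunctorOfCategory
      (Cor53.hasUnder_baseFunctor_model (DivB := C.divBNatTrans) h hpf hsl hfs hnd hz)
      (Cor53.underUnique_baseFunctor_model (DivB := C.divBNatTrans) h hpf hsl hfs hnd hz) :=
  Cor53.tempered_descendBijective_of_monoidRigid_of_lifts C h hpf hsl hfs hnd hz hmon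
    (tempered_lifts_of_dataAction C ρ δ hδη hδβ hgeom)

end Tempered

/-! ### §3. Non-vacuity of the generic engine at a toy datum: the zero-data model Frobenioid lifts EVERY base self-equivalence -/

section NonVacuity

universe w v u

variable {D : Type u} [Category.{v} D]

/-- Every element of the groupification of a monoid all of whose elements are `1` is `1`. [folklore] -/
private theorem grothendieckGroup_eq_one_of_forall {M : Type w} [CommMonoid M] (hM : ∀ a : M, a = 1)
    (x : Algebra.GrothendieckGroup M) : x = 1 := by
  have h : MonoidHom.id (Algebra.GrothendieckGroup M) = 1 :=
    MonGp.hom_ext fun a => by rw [MonoidHom.id_apply, MonoidHom.one_apply, hM a, map_one]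
  exact DFunLike.congr_fun h x

/-- **NON-VACUITY at a toy datum** (OUR toy, labelled: the genuine datum at `v̲` is FOUNDATIONS-14): over ANY base `D`, the model
Frobenioid of the ZERO data `(0_D, 0_D, Div)` (`Φ = B =` abc-iut-L1's `zeroMonoid D`, [FrdI] Prop 4.4 (i)) lifts EVERY self-equivalence
`Θ` of `D` — the hypotheses of `lifts_of_dataAction` are jointly satisfiable with NON-identity `Θ` (`G := D ≌ D`, `ρ := id`, the data
action trivial), so the engine is not vacuous. ([IUTchI] Cor 5.3 (iv) p.144) [cite: MochizukiFrdI2008, Prop. 4.4(i) p.83]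
[claim: Mochizuki2012, status: disputed] -/
theorem zeroData_lifts (DivB : zeroMonoid.{w} D ⟶ monoidGp (zeroMonoid.{w} D)) (Θ : D ≌ D) :
    ∃ Ψ : ModelFrobenioid (zeroMonoid.{w} D) (zeroMonoid.{w} D) DivB ≌ ModelFrobenioid (zeroMonoid.{w} D) (zeroMonoid.{w} D) DivB,
      Nonempty (CatIsomorphism.LiesUnder (ModelFrobenioid.baseFunctor _ _ DivB) (ModelFrobenioid.baseFunctor _ _ DivB) Ψ Θ) := by
  -- the trivial data action of `G := D ≌ D` (`ρ := id`) on the zero data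
  let η : ∀ Θ' : D ≌ D, (zeroMonoid.{w} D ⟶ Θ'.functor.op ⋙ zeroMonoid.{w} D) := fun Θ' =>
    { app := fun A => CommMonCat.ofHom (MonoidHom.id PUnit)
      naturality := fun A A' f => by apply CommMonCat.hom_ext; rfl }
  let δ : ∀ Θ' : D ≌ D, ModelFrobenioid.DataHomOver Θ'.functor DivB DivB := fun Θ' =>
    { η := η Θ'
      β := η Θ'
      comm := fun A u =>
        (grothendieckGroup_eq_one_of_forall (fun _ => rfl) _).trans
          (grothendieckGroup_eq_one_of_forall (fun _ => rfl) _).symm }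
  have hb : ∀ (Θ' : D ≌ D) (X : D), Bijective ((η Θ').app (op X)).hom := fun Θ' X =>
    ⟨fun a b _ => rfl, fun b => ⟨b, rfl⟩⟩
  exact lifts_of_dataAction (G := D ≌ D) id δ hb hb (fun Θ' => ⟨Θ', ⟨Iso.refl _⟩⟩) Θ

end NonVacuity

/-! ### §4 (v2, append-only). The junction with lane 1 in ITS currency: `DescendBijective` from `RigidOverBase` (injectivity, any
route — `hrat` through ★ p516053 or abc-iut-L2-t12's `DivisorDataRigid`) + the data action (surjectivity, this file) -/

section Junction

universe u₀ v₀ u v w uG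

variable {D₀ : Type u₀} [Category.{v₀} D₀] {V : FrdIMonoidStub.{w}} {T : RealifiedDivisorMonoids (D₀ := D₀) V}
  {D : Type u} [Category.{v} D] {VD : FrdICatStub.{u, v, w} D} (C : TemperedFrobenioid T D VD) {G : Type uG}

/-- **[IUTchI] Cor 5.3 (iv) AS PRINTED («is bijective») AT every [EtTh] Def 3.6 tempered Frobenioid — the TWO-LANE JUNCTION in the
currency of record**: `DescendBijective` (the §0 natural map `Aut(ℱ̲_v) → Aut(𝒟_v)` is bijective) from (INJ) `RigidOverBase
(C.category → D)` — lane 1's conclusion BY NAME, however obtained (abc-iut-L5-t4's ★ p516053 `Cor53.tempered_rigidOverBase_of_divRatioRigid`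
from print-strength `hrat`, or abc-iut-L2-t12's `rigidOverBase_of_divisorDataRigid` from `DivisorDataRigid`) — and (SURJ) the data action
`(ρ, δ, hgeom)` of this file (`tempered_lifts_of_dataAction`), via the §0 kernel form `CatIsomorphism.descend_injective_of_kernel_trivial` and
`descend_surjective_of_lifts`.  Binders: six [FrdI] standing hypotheses BY NAME (for `HasUnder`/`UnderUnique`, [FrdI] Cor 4.11 (ii) at
the model) · LAW/FACT-SHAPE {hker := RigidOverBase (lane 1), δ, hgeom}.  HONEST LABEL: at the [EtTh] carrier (where, at DESIGN instances
with a left group action on the prime data, `RigidOverBase` is refutable as typed — abc-iut-L2-t12 census R1444); at `v̲` FOUNDATIONS-14.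
([IUTchI] Cor 5.3 (iv) p.144) [cite: MochizukiEtTh2009, Def 3.6 p.77] [claim: Mochizuki2012, status: disputed] -/
theorem tempered_descendBijective_of_rigidOverBase_of_dataAction
    (h : ModelFrobenioid.Hypotheses C.divisorMonoid C.ratFnFunctor)
    (hpf : Objectwise (fun M _ => IsPerfFactorial M) C.divisorMonoid) (hsl : IsSlim D) (hfs : IsOfFSMFFType D)
    (hnd : IsNonDilatingOn C.divisorMonoid) (hz : ¬ ModelFrobenioid.IsZeroMonoid C.divisorMonoid)
    (hker : CatIsomorphism.RigidOverBase C.baseFunctorOfCategory)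
    (ρ : G → (D ≌ D)) (δ : ∀ g, ModelFrobenioid.DataHomOver (ρ g).functor C.divBNatTrans C.divBNatTrans)
    (hδη : ∀ g (X : D), Bijective ((δ g).η.app (op X)).hom) (hδβ : ∀ g (X : D), Bijective ((δ g).β.app (op X)).hom)
    (hgeom : ∀ Θ : D ≌ D, ∃ g, Nonempty ((ρ g).functor ≅ Θ.functor)) :
    CatIsomorphism.DescendBijective C.baseFunctorOfCategory C.baseFunctorOfCategory
      (Cor53.hasUnder_baseFunctor_model (DivB := C.divBNatTrans) h hpf hsl hfs hnd hz)
      (Cor53.underUnique_baseFunctor_model (DivB := C.divBNatTrans) h hpf hsl hfs hnd hz) :=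
  ⟨CatIsomorphism.descend_injective_of_kernel_trivial _ _ hker,
    CatIsomorphism.descend_surjective_of_lifts _ _ (tempered_lifts_of_dataAction C ρ δ hδη hδβ hgeom)⟩

/-- **The same with lane 1's PRINT-STRENGTH law `hrat`** (abc-iut-L5-t4's ★ p516053 shape: through some `η`, `Ψ` over `id_D` induces the
identity on the divisor monoid and preserves the birational units of parallel linear arrows — steps S3–S5 of p. 145; abc-iut-L2-t12's
`hrat_of_divisorDataRigid` PRODUCES it): `Cor53.tempered_descendBijective_of_divRatioRigid_of_lifts` with `hlift` DISCHARGED by the data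
action. ([IUTchI] Cor 5.3 (iv) p.144) [cite: MochizukiEtTh2009, Def 3.6 p.77] [claim: Mochizuki2012, status: disputed] -/
theorem tempered_descendBijective_of_divRatioRigid_of_dataAction
    (h : ModelFrobenioid.Hypotheses C.divisorMonoid C.ratFnFunctor)
    (hpf : Objectwise (fun M _ => IsPerfFactorial M) C.divisorMonoid) (hsl : IsSlim D) (hfs : IsOfFSMFFType D)
    (hnd : IsNonDilatingOn C.divisorMonoid) (hz : ¬ ModelFrobenioid.IsZeroMonoid C.divisorMonoid)
    (hrat : ∀ Ψ : C.category ≌ C.category,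
      Nonempty (Ψ.functor ⋙ C.baseFunctorOfCategory ≅ C.baseFunctorOfCategory) →
      ∃ η : Ψ.functor ⋙ C.baseFunctorOfCategory ≅ C.baseFunctorOfCategory,
        (∀ ⦃X Y : C.category⦄ (φ : X ⟶ Y),
            ModelFrobenioid.div (Ψ.functor.map φ) =
              pull C.divisorMonoid (η.hom.app X : (Ψ.functor.obj X).base ⟶ X.base) (ModelFrobenioid.div φ)) ∧
        (∀ ⦃X Y : C.category⦄ (f g : X ⟶ Y), ModelFrobenioid.degFr f = 1 →
            ModelFrobenioid.degFr g = 1 → ModelFrobenioid.baseMap f = ModelFrobenioid.baseMap g →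
            ModelFrobenioid.unit (Ψ.functor.map f) *
                pull C.ratFnFunctor (A := X.base) (B := (Ψ.functor.obj X).base) (η.hom.app X) (ModelFrobenioid.unit g) =
              ModelFrobenioid.unit (Ψ.functor.map g) *
                pull C.ratFnFunctor (A := X.base) (B := (Ψ.functor.obj X).base) (η.hom.app X)
                  (ModelFrobenioid.unit f)))
    (ρ : G → (D ≌ D)) (δ : ∀ g, ModelFrobenioid.DataHomOver (ρ g).functor C.divBNatTrans C.divBNatTrans)
    (hδη : ∀ g (X : D), Bijective ((δ g).η.app (op X)).hom) (hδβ : ∀ g (X : D), Bijective ((δ g).β.app (op X)).hom)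
    (hgeom : ∀ Θ : D ≌ D, ∃ g, Nonempty ((ρ g).functor ≅ Θ.functor)) :
    CatIsomorphism.DescendBijective C.baseFunctorOfCategory C.baseFunctorOfCategory
      (Cor53.hasUnder_baseFunctor_model (DivB := C.divBNatTrans) h hpf hsl hfs hnd hz)
      (Cor53.underUnique_baseFunctor_model (DivB := C.divBNatTrans) h hpf hsl hfs hnd hz) :=
  Cor53.tempered_descendBijective_of_divRatioRigid_of_lifts C h hpf hsl hfs hnd hz hrat
    (tempered_lifts_of_dataAction C ρ δ hδη hδβ hgeom)

end Junction

end Cor53iv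

end Literature.IUT.HodgeTheaters
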